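import Summits.Ventures.PercRepro.GenQTracePlanes
import Summits.Ventures.PercRepro.GenQChargeBounds

/-!
# PercRepro — the row (R1), part 1: plane-type pairs above a basis (night-4, gen 4)

Above a basis `B₀`, the pairs `{x, y} ⊆ G ∖ B₀` with `B₀ ∪ {x, y}` plane-type (`m = q − 3`, i.e. `|C_x ∪ C_y| = 5`:
a `5`-point plane plus `q − 3` coloops) are of three kinds: two `2`-traces sharing a basis point — the `2`-paths of the
trace graph on `B₀`, at most `Σ_b C(deg b, 2) ≤ (q − 2)·k₂` as `deg b ≤ q − 1` —, or a `3`-trace `T` with the other trace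
inside `T`: at most `2` partners per `3`-trace (`|K_T| ≤ 3`).  With `nb(S) ≥ 8` for the level-`(d−2)` plane-type sets
(a `5`-point rank-`3` set has at most `2` collinear triples):
**`8·#Pc (d−2) (q−3) ≤ 3(q−2)·#Pc (d−1) (q−2) + 8·#Pc (d−1) (q−3)`** (`card_Pc_sub_two_plane_le` in `GenQTracePairsBound`; at
`q = 6` the row `8·Pc[d−2][3] ≤ 12·Pc[d−1][4] + 8·Pc[d−1][3]` of sheet §55, (R1) with `λ = 4`).  This part: `planePairs`,
`sum_nb_pair_le`, `eight_le_nb`, the shape of a pair (`fc_union_card_of_planePair`), the `2`-trace points `D_b` through a basis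
point with `card_Db_le` (`≤ q − 1`) and `sum_card_Db_eq` (`Σ_b |D_b| = 2·k₃`).

Imports `GenQTracePlanes` and `GenQChargeBounds` (`five_le_card_union_fc`).
-/
namespace PercRepro.Night4

open Finset ThmH SixFour GenQ PerFlat Star

variable {α : Type*} [DecidableEq α] {M : Matroid α} [M.Finite]

/-- The plane-type pairs above `B₀`: `{x, y} ⊆ G ∖ B₀` with `m(B₀ ∪ {x, y}) = q − 3`. -/
noncomputable def planePairs (M : Matroid α) [M.Finite] (G B₀ : Finset α) (q : ℕ) : Finset (Finset α) :=
  ((G \ B₀).powersetCard 2).filter (fun P => mTr M (B₀ ∪ P) = q - 3)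

/-- **`Σ_{S ∈ Pc (d−2) (q−3)} nb S ≤ Σ_{B₀} #planePairs B₀`**: `(S, B₀) ↦ (B₀, S ∖ B₀)` is injective. -/
theorem sum_nb_pair_le {G : Finset α} {q d : ℕ} (hcard : G.card = q + d) (hd : 2 ≤ d) :
    ∑ S ∈ Pc M G q (d - 2) (q - 3), nb M G S q ≤ ∑ B₀ ∈ basesOf M G q, (planePairs M G B₀ q).card := by
  unfold nb
  rw [← Finset.card_sigma, ← Finset.card_sigma]
  apply Finset.card_le_card_of_injOn (fun p => ⟨p.2, p.1 \ p.2⟩)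
  · rintro ⟨S, B₀⟩ hp
    rw [Finset.mem_coe, Finset.mem_sigma, Finset.mem_filter] at hp
    simp only at hp ⊢
    obtain ⟨hS, hB₀, hBS⟩ := hp
    have hS' := mem_Pc.1 hS
    have hSG := (mem_Rq.1 hS'.1).1
    have hB := mem_basesOf.1 hB₀
    rw [Finset.mem_coe, Finset.mem_sigma]
    refine ⟨hB₀, ?_⟩
    unfold planePairs
    rw [Finset.mem_filter, Finset.mem_powersetCard]
    have hSc : S.card = q + 2 := by
      have h1 : (G \ S).card + S.card = G.card := by
        rw [Finset.card_sdiff_of_subset hSG]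
        exact Nat.sub_add_cancel (Finset.card_le_card hSG)
      rw [hS'.2.1, hcard] at h1
      omega
    refine ⟨⟨Finset.sdiff_subset_sdiff hSG (Finset.Subset.refl _), ?_⟩, ?_⟩
    · rw [Finset.card_sdiff_of_subset hBS, hSc, hB.2.2]
      omega
    · rw [Finset.union_sdiff_of_subset hBS]
      exact hS'.2.2
  · rintro ⟨S, B₀⟩ hp ⟨S', B₀'⟩ hp' heq
    rw [Finset.mem_coe, Finset.mem_sigma, Finset.mem_filter] at hp hp'
    simp only at hp hp'
    simp only [Sigma.mk.injEq] at heq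
    obtain ⟨hBeq, hPeq⟩ := heq
    subst hBeq
    have hPeq' : S \ B₀ = S' \ B₀ := eq_of_heq hPeq
    have e1 : S = B₀ ∪ (S \ B₀) := (Finset.union_sdiff_of_subset hp.2.2).symm
    have e2 : S' = B₀ ∪ (S' \ B₀) := (Finset.union_sdiff_of_subset hp'.2.2).symm
    rw [e1, e2, hPeq']

/-- **`nb(S) ≥ 8`** for a level-`(d−2)` plane-type set (a `5`-point rank-`3` set `Z` plus `q − 3` coloops): `Z` has at most
two collinear triples, so `≥ 8` triples of rank `3`, each giving a basis `T ∪ K` inside `S`. -/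
theorem eight_le_nb (hs : Simple M) (hline : ∀ L ∈ flatsQ M 2, L.card ≤ 3) {G S : Finset α} {q d : ℕ}
    (hG : G ⊆ gr M) (hq : 3 ≤ q) (hcard : G.card = q + d) (hS : S ∈ Pc M G q (d - 2) (q - 3)) (hd : 2 ≤ d) :
    8 ≤ nb M G S q := by
  obtain ⟨hZr, hZc⟩ := cyclic_part_of_plane_type hG hq hcard hS
  have hS' := mem_Pc.1 hS
  have hSG := (mem_Rq.1 hS'.1).1
  have hZg : S \ coloopsOf M S ⊆ gr M := Finset.sdiff_subset.trans (hSG.trans hG)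
  have h5 : (S \ coloopsOf M S).card = 5 := by rw [hZc]; omega
  -- rank-`3` triples `≥ 10 − 2`
  have htr : 8 ≤ (((S \ coloopsOf M S).powersetCard 3).filter
      (fun T : Finset α => M.eRk (T : Set α) = 3)).card := by
    have h1 := choose_three_le_rank_three_add_collinear (M := M) (S \ coloopsOf M S)
    have h2 := card_collinear_le_two hs hline hZg h5
    rw [h5] at h1
    have hc : Nat.choose 5 3 = 10 := by decide
    rw [hc] at h1
    omega
  unfold nb
  refine le_trans htr (Finset.card_le_card_of_injOn (fun T => T ∪ coloopsOf M S) ?_ ?_)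
  · intro T hT
    rw [Finset.mem_coe, Finset.mem_filter, Finset.mem_powersetCard] at hT
    obtain ⟨⟨hTZ, hTc⟩, hTr⟩ := hT
    rw [Finset.mem_coe, Finset.mem_filter]
    have hdisj : Disjoint T (coloopsOf M S) := by
      rw [Finset.disjoint_left]
      intro y hyT hyK
      exact (Finset.mem_sdiff.1 (hTZ hyT)).2 hyK
    have hsub : T ∪ coloopsOf M S ⊆ S := Finset.union_subset (hTZ.trans Finset.sdiff_subset) (coloopsOf_subset S)
    have hr := eRk_union_coloopsOf_eq hG hS'.1 hTZ
    rw [hTr, hS'.2.2] at hr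
    have hr' : M.eRk ((T ∪ coloopsOf M S : Finset α) : Set α) = (q : ℕ∞) := by
      rw [hr]
      norm_cast
      omega
    refine ⟨mem_basesOf.2 ⟨hsub.trans hSG, hr', ?_⟩, hsub⟩
    rw [Finset.card_union_of_disjoint hdisj, hTc]
    unfold mTr at hS'
    omega
  · intro T hT T' hT' heq
    rw [Finset.mem_coe, Finset.mem_filter, Finset.mem_powersetCard] at hT hT'
    have hdisj : ∀ U, U ⊆ S \ coloopsOf M S → Disjoint U (coloopsOf M S) := fun U hU => by
      rw [Finset.disjoint_left]
      intro y hyU hyK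
      exact (Finset.mem_sdiff.1 (hU hyU)).2 hyK
    have e1 := Finset.union_sdiff_cancel_right (hdisj T hT.1.1)
    have e2 := Finset.union_sdiff_cancel_right (hdisj T' hT'.1.1)
    simp only at heq
    rw [← e1, ← e2, heq]

/-! ## The shape of a plane-type pair -/

/-- For a plane-type pair `{x, y}` above `B₀`: `|C_x ∪ C_y| = 5`, both circuits have `3` or `4` points. -/
theorem fc_union_card_of_planePair (hs : Simple M) (hline : ∀ L ∈ flatsQ M 2, L.card ≤ 3) {G B₀ : Finset α}
    {q : ℕ} (hG : G ⊆ gr M) (hrG : M.eRk (G : Set α) = (q : ℕ∞)) (hq : 3 ≤ q) (hB : B₀ ∈ basesOf M G q) {x y : α}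
    (hx : x ∈ G) (hxB : x ∉ B₀) (hy : y ∈ G) (hyB : y ∉ B₀) (hxy : x ≠ y)
    (hm : mTr M (insert x (insert y B₀)) = q - 3) :
    (fc M x B₀ ∪ fc M y B₀).card = 5 ∧ 3 ≤ (fc M x B₀).card ∧ (fc M x B₀).card ≤ 4 ∧
      3 ≤ (fc M y B₀).card ∧ (fc M y B₀).card ≤ 4 := by
  have hBG := (mem_basesOf.1 hB).1
  have hI := indep_of_mem_basesOf hB
  have hne : B₀.Nonempty := Finset.card_pos.1 (by rw [(mem_basesOf.1 hB).2.2]; omega)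
  have h5 := five_le_card_union_fc hs hline hG hrG hB (by omega) hx hxB hy hyB hxy
  have hle := mTr_pair_le hG hrG hB hx hxB hy hyB hxy
  rw [hm] at hle
  have hu : (fc M x B₀ ∪ fc M y B₀).card = 5 := by omega
  have h3x := three_le_card_fc hs (hBG.trans hG) (hG hx) hI (mem_closure_of_mem_basesOf hG hrG hB hx) hxB hne
  have h3y := three_le_card_fc hs (hBG.trans hG) (hG hy) hI (mem_closure_of_mem_basesOf hG hrG hB hy) hyB hne
  -- `y ∈ C_y ∖ C_x` and `x ∈ C_x ∖ C_y`, so each circuit misses a point of the union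
  have hyx : y ∉ fc M x B₀ := fun h => by
    have := fc_subset_insert x B₀ h
    rw [Finset.mem_insert] at this
    rcases this with h' | h'
    · exact hxy h'.symm
    · exact hyB h'
  have hxy' : x ∉ fc M y B₀ := fun h => by
    have := fc_subset_insert y B₀ h
    rw [Finset.mem_insert] at this
    rcases this with h' | h'
    · exact hxy h'
    · exact hxB h'
  have hx4 : (fc M x B₀).card ≤ 4 := by
    have : insert y (fc M x B₀) ⊆ fc M x B₀ ∪ fc M y B₀ :=
      Finset.insert_subset (Finset.mem_union_right _ (mem_fc_self y B₀)) Finset.subset_union_left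
    have := Finset.card_le_card this
    rw [Finset.card_insert_of_notMem hyx, hu] at this
    omega
  have hy4 : (fc M y B₀).card ≤ 4 := by
    have : insert x (fc M y B₀) ⊆ fc M x B₀ ∪ fc M y B₀ :=
      Finset.insert_subset (Finset.mem_union_left _ (mem_fc_self x B₀)) Finset.subset_union_right
    have := Finset.card_le_card this
    rw [Finset.card_insert_of_notMem hxy', hu] at this
    omega
  exact ⟨hu, h3x, hx4, h3y, hy4⟩

/-- The `2`-trace points through `b ∈ B₀`: `D_b = {x ∈ G ∖ B₀ : |C_x| = 3, b ∈ C_x}`. -/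
noncomputable def Db (M : Matroid α) [M.Finite] (G B₀ : Finset α) (b : α) : Finset α :=
  (G \ B₀).filter (fun x => (fc M x B₀).card = 3 ∧ b ∈ fc M x B₀)

/-- **`|D_b| ≤ q − 1`**: the `2`-traces through `b` are distinct pairs `{b, b′}` (lines `≤ 3`). -/
theorem card_Db_le (hs : Simple M) (hline : ∀ L ∈ flatsQ M 2, L.card ≤ 3) {G B₀ : Finset α} {q : ℕ}
    (hG : G ⊆ gr M) (hrG : M.eRk (G : Set α) = (q : ℕ∞)) (hq : 3 ≤ q) (hB : B₀ ∈ basesOf M G q) {b : α}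
    (hb : b ∈ B₀) : (Db M G B₀ b).card ≤ q - 1 := by
  obtain ⟨hBG, _, hc⟩ := mem_basesOf.1 hB
  -- `x ↦ C_x ∖ {x, b}` is a singleton `{b′}` of `B₀ ∖ b`; distinct `x` give distinct `b′`
  have hcard : ∀ x ∈ Db M G B₀ b, ((fc M x B₀).erase x).erase b ⊆ B₀.erase b ∧
      (((fc M x B₀).erase x).erase b).card = 1 := by
    intro x hx
    unfold Db at hx
    rw [Finset.mem_filter, Finset.mem_sdiff] at hx
    obtain ⟨⟨hxG, hxB⟩, h3, hbC⟩ := hx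
    refine ⟨?_, ?_⟩
    · intro z hz
      rw [Finset.mem_erase] at hz ⊢
      exact ⟨hz.1, fc_erase_subset x hz.2⟩
    · have hbx : b ≠ x := fun h => hxB (h ▸ hb)
      rw [Finset.card_erase_of_mem (Finset.mem_erase.2 ⟨hbx, hbC⟩), Finset.card_erase_of_mem (mem_fc_self x B₀), h3]
  calc (Db M G B₀ b).card ≤ ((Db M G B₀ b).image (fun x => ((fc M x B₀).erase x).erase b)).card := by
        apply le_of_eq
        symm
        apply Finset.card_image_of_injOn
        intro x hx x' hx' heq
        rw [Finset.mem_coe] at hx hx'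
        simp only at heq
        by_contra hne
        -- the same trace `{b, b′}` for `x ≠ x′`: the union of the two circuits has `4` points
        unfold Db at hx hx'
        rw [Finset.mem_filter, Finset.mem_sdiff] at hx hx'
        obtain ⟨⟨hxG, hxB⟩, h3, hbC⟩ := hx
        obtain ⟨⟨hx'G, hx'B⟩, h3', hbC'⟩ := hx'
        have h5 := five_le_card_union_fc hs hline hG hrG hB (by omega) hxG hxB hx'G hx'B hne
        have hsub : fc M x B₀ ∪ fc M x' B₀ ⊆ insert x (insert x' ((fc M x B₀).erase x)) := by
          intro z hz
          rw [Finset.mem_union] at hz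
          rw [Finset.mem_insert, Finset.mem_insert, Finset.mem_erase]
          rcases hz with h | h
          · by_cases hzx : z = x
            · exact Or.inl hzx
            · exact Or.inr (Or.inr ⟨hzx, h⟩)
          · by_cases hzx' : z = x'
            · exact Or.inr (Or.inl hzx')
            · right; right
              -- `z ∈ C_{x′} ∖ x′`: either `z = b` or `z ∈ (C_{x′} ∖ x′) ∖ b = (C_x ∖ x) ∖ b`
              by_cases hzb : z = b
              · exact ⟨fun h' => hxB (h' ▸ hzb ▸ hb), hzb ▸ hbC⟩
              · have hz' : z ∈ ((fc M x' B₀).erase x').erase b := Finset.mem_erase.2 ⟨hzb, Finset.mem_erase.2 ⟨hzx', h⟩⟩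
                rw [← heq] at hz'
                exact Finset.mem_erase.1 (Finset.mem_erase.1 hz').2
        have := Finset.card_le_card hsub
        have hc1 : (insert x (insert x' ((fc M x B₀).erase x))).card ≤ 4 := by
          calc (insert x (insert x' ((fc M x B₀).erase x))).card ≤ (insert x' ((fc M x B₀).erase x)).card + 1 :=
                Finset.card_insert_le _ _
            _ ≤ ((fc M x B₀).erase x).card + 1 + 1 := by
                gcongr
                exact Finset.card_insert_le _ _
            _ ≤ 4 := by rw [Finset.card_erase_of_mem (mem_fc_self x B₀), h3]
        omega
    _ ≤ ((B₀.erase b).powersetCard 1).card := by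
        apply Finset.card_le_card
        intro U hU
        rw [Finset.mem_image] at hU
        obtain ⟨x, hx, rfl⟩ := hU
        rw [Finset.mem_powersetCard]
        exact hcard x hx
    _ = q - 1 := by rw [Finset.card_powersetCard, Finset.card_erase_of_mem hb, hc, Nat.choose_one_right]

/-- **`Σ_{b ∈ B₀} |D_b| = 2·k₃(B₀)`** — every `2`-trace point lies on exactly two `D_b`. -/
theorem sum_card_Db_eq (G B₀ : Finset α) :
    ∑ b ∈ B₀, (Db M G B₀ b).card = 2 * kc M G B₀ 3 := by
  unfold Db kc
  simp only [Finset.card_filter]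
  rw [Finset.sum_comm, Finset.mul_sum]
  apply Finset.sum_congr rfl
  intro x hx
  by_cases h3 : (fc M x B₀).card = 3
  · have hfil : (B₀.filter (fun b => b ∈ fc M x B₀)) = (fc M x B₀).erase x := by
      ext b
      rw [Finset.mem_filter, Finset.mem_erase]
      constructor
      · rintro ⟨hbB, hbC⟩
        exact ⟨fun h => (Finset.mem_sdiff.1 hx).2 (h ▸ hbB), hbC⟩
      · rintro ⟨hbx, hbC⟩
        exact ⟨fc_erase_subset x (Finset.mem_erase.2 ⟨hbx, hbC⟩), hbC⟩
    have h2 : (B₀.filter (fun b => b ∈ fc M x B₀)).card = 2 := by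
      rw [hfil, Finset.card_erase_of_mem (mem_fc_self x B₀), h3]
    rw [if_pos h3]
    calc ∑ b ∈ B₀, (if (fc M x B₀).card = 3 ∧ b ∈ fc M x B₀ then 1 else 0)
        = ∑ b ∈ B₀, (if b ∈ fc M x B₀ then 1 else 0) := by
          apply Finset.sum_congr rfl
          intro b _
          simp only [h3, true_and]
      _ = (B₀.filter (fun b => b ∈ fc M x B₀)).card := by
          rw [Finset.card_filter]
      _ = 2 * 1 := by rw [h2]
  · rw [if_neg h3]
    simp only [h3, false_and, if_false, Finset.sum_const_zero, mul_zero]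

end PercRepro.Night4
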